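import Summits.MatrixMultiplication.OmegaCensus.STPPVosperSlackTwoCheckersC
import Summits.MatrixMultiplication.OmegaCensus.STPPVosperSlackTwoSoundReal
import Summits.MatrixMultiplication.OmegaCensus.STPPVosperSlackTwoShapes

/-!
# ω-census (abelian STPP census): SOUNDNESS of the slack-2 case-C checker in normal form (kernel tool)

HONEST FRAMING (pub-omega census; verbatim): lottery ticket; floor = certified bounds/negative ranges.
Census STRUCTURE (seat pub-omega-stpp-1 gen 32, 2026-08-28), family (b2).  `caseCDeadQP'_false_of_normal_form`: a two-block STPP family of `ℤ/p` in
case-C normal form — `0 ∈ C 0`, `0 ∈ B 1`, `#T = #B0 + z`, `W ∪ SY ∪ T = ℤ/p`, `Z° = C 1 − A 1 = ζ₀ + ([0, z] ∖ {h₀})` (`z + 1 ≤ p`) — makes the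
case-C checker `caseCDeadQP'` (`STPPVosperSlackTwoCheckersC.lean`) return `false` on the value lists of `B 0` and `A 0`: the family passes the pattern,
tiling, candidate (`Z° ⊆ zc` as `T ∩ W = ∅`), interval/hole, sumset-mask (`tM` = values of `T`, `sy` = values of `SY` by the partition, `syM = sy`
by `Nat.eq_of_testBit_eq`), `Y°`-sublist and realisation stages (`false_of_realisationsDead`).  What remains for the law: the REDUCTION of a case-(C)
family (Hamidoune–Rødseth shapes) to this normal form.  UNCONDITIONAL; no `decide`.  Nothing here is progress on `ω`.
References: H. Cohn, R. Kleinberg, B. Szegedy, C. Umans, FOCS 2005 (arXiv:math/0511460), Def. 5.1; Y. O. Hamidoune, Ø. J. Rødseth, Acta Arith. 92 (2000).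
-/

open Finset
open scoped Pointwise
namespace Summit.MatrixMultiplication.OmegaCensus.CubeNB.S2

open Literature.Computability.AlgebraicComplexity
open Literature.Combinatorics.Additive
open Summit.MatrixMultiplication.OmegaCensus.STPPKneser
open Summit.MatrixMultiplication.OmegaCensus.CubeNB.Bits
variable {p : ℕ} [hp : Fact p.Prime]

/-- **NORMAL-FORM SOUNDNESS of the case-C checker.**  See the module docstring. [cite: CohnKleinbergSzegedyUmans2005, Def. 5.1]
[cite: HamidouneRodseth2000, main theorem (§1, p. 252)] -/
theorem caseCDeadQP'_false_of_normal_form {A B C : Fin 2 → Finset (ZMod p)} (hS : IsSTPP A B C)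
    (hA : ∀ k, (A k).Nonempty) (hB : ∀ k, (B k).Nonempty) (hC : ∀ k, (C k).Nonempty)
    {b c L z a₀ b₀ c₀ : ℕ} (hb : #(B 0) = b) (hc : #(C 0) = c) (ha₀ : #(A 1) = a₀) (hb₀ : #(B 1) = b₀) (hc₀ : #(C 1) = c₀)
    (hL : b₀ * c₀ = L) (hzp : z + 1 ≤ p)
    (hC00 : (0 : ZMod p) ∈ C 0) (hB10 : (0 : ZMod p) ∈ B 1)
    (hT : #((B 0).image (fun x => (0 : ZMod p) - x) + DU A C (univ.erase 0)) = b + z)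
    (hpart : (((A 0) ×ˢ ((B 0) ×ˢ (C 0))).image fun q : ZMod p × ZMod p × ZMod p => (0 : ZMod p) + q.2.2 - q.1 - q.2.1) ∪
        ((A 0).image (fun x => (0 : ZMod p) - x) + DU B C (univ.erase 0)) ∪ ((B 0).image (fun x => (0 : ZMod p) - x) + DU A C (univ.erase 0)) = univ)
    {ζ₀ : ZMod p} {h₀ : ℕ} (hh₀ : h₀ ≤ z)
    (hZ : DU A C (univ.erase 0) = ((Finset.range (z + 1)).erase h₀).image fun t : ℕ => ζ₀ + (t : ZMod p)) :
    caseCDeadQP' p c L z a₀ b₀ c₀ (((B 0).image ZMod.val).sort (· ≤ ·)) (((A 0).image ZMod.val).sort (· ≤ ·)) = false := by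
  rw [Bool.eq_false_iff]; intro h
  have hp0 : 0 < p := hp.out.pos; have h1 : (univ : Finset (Fin 2)).erase 0 = {1} := by decide
  set Q := ((B 0).image ZMod.val).sort (· ≤ ·) with hQdef
  set P := ((A 0).image ZMod.val).sort (· ≤ ·) with hPdef
  obtain ⟨hQmem, hQnd, hQlt, hQlen⟩ := valList_spec (B 0)
  obtain ⟨hPmem, hPnd, hPlt, hPlen⟩ := valList_spec (A 0)
  set patt := pattPQ p P Q with hpattdef
  have hpatt_mem : ∀ w, w ∈ patt ↔ ∃ x ∈ A 0, ∃ bb ∈ B 0, (x.val + bb.val) % p = w := by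
    intro w; rw [hpattdef, pattPQ, List.mem_flatMap]
    constructor
    · rintro ⟨xv, hxv, hw⟩
      rw [List.mem_map] at hw
      obtain ⟨q, hq, rfl⟩ := hw
      obtain ⟨x, hx, rfl⟩ := (hPmem xv).1 hxv
      obtain ⟨bb, hbb, rfl⟩ := (hQmem q).1 hq; exact ⟨x, hx, bb, hbb, rfl⟩
    · rintro ⟨x, hx, bb, hbb, rfl⟩
      exact ⟨x.val, (hPmem _).2 ⟨x, hx, rfl⟩, List.mem_map.2 ⟨bb.val, (hQmem _).2 ⟨bb, hbb, rfl⟩, rfl⟩⟩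
  have hpatt_cast : ∀ (x bb : ZMod p), ((((x.val + bb.val) % p : ℕ)) : ZMod p) = x + bb := fun x bb => by
    rw [cast_add_mod, ZMod.natCast_zmod_val, ZMod.natCast_zmod_val]
  have hpatt : patt.Nodup := by
    rw [hpattdef, pattPQ, List.nodup_flatMap]
    constructor
    · intro xv hxv
      refine List.Nodup.map_on (fun q hq q' hq' hqq => ?_) hQnd
      have hq1 := hQlt q hq
      have hq2 := hQlt q' hq'
      have := congrArg (fun n : ℕ => (n : ZMod p)) hqq
      simp only [cast_add_mod, add_right_inj] at this
      have := congrArg ZMod.val this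
      rwa [ZMod.val_natCast_of_lt hq1, ZMod.val_natCast_of_lt hq2] at this
    · refine hPnd.imp_of_mem ?_
      intro xv xv' hxv hxv' hne v hv hv'
      rw [List.mem_map] at hv hv'
      obtain ⟨q, hq, rfl⟩ := hv
      obtain ⟨q', hq', hqq⟩ := hv'
      obtain ⟨x, hx, rfl⟩ := (hPmem xv).1 hxv
      obtain ⟨x', hx', rfl⟩ := (hPmem xv').1 hxv'
      obtain ⟨bb, hbb, rfl⟩ := (hQmem q).1 hq
      obtain ⟨bb', hbb', rfl⟩ := (hQmem q').1 hq'
      have hcast := congrArg (fun n : ℕ => (n : ZMod p)) hqq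
      simp only [hpatt_cast] at hcast
      obtain ⟨hxx, -⟩ := add_injOn_AB hS hC 0 hx' hx hbb' hbb hcast; exact hne (by rw [hxx])
  set W := ((A 0) ×ˢ ((B 0) ×ˢ (C 0))).image fun q : ZMod p × ZMod p × ZMod p => (0 : ZMod p) + q.2.2 - q.1 - q.2.1 with hW
  set SY := (A 0).image (fun x => (0 : ZMod p) - x) + DU B C (univ.erase 0) with hSYdef
  set T := (B 0).image (fun x => (0 : ZMod p) - x) + DU A C (univ.erase 0) with hTdef
  have hWSY : Disjoint W SY := disjoint_W_negA_add_DU hS 0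
  have hTWSY : Disjoint T (W ∪ SY) := disjoint_negB_add_DU_AC hS 0
  have hmemW : ∀ x ∈ A 0, ∀ bb ∈ B 0, ∀ cc ∈ C 0, cc - x - bb ∈ W := fun x hx bb hbb cc hcc =>
    mem_image.2 ⟨(x, bb, cc), mem_product.2 ⟨hx, mem_product.2 ⟨hbb, hcc⟩⟩, by ring⟩
  have hT0 : ((transMasks p patt).headD (0, 0)).2 = maskOf (patt.map fun w => (0 + p - w) % p) := transMasks_headD patt hp0
  have htrans_mem : ∀ (r w : ℕ) (cc : ZMod p), cc.val = r → w ∈ patt →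
      ∃ x ∈ A 0, ∃ bb ∈ B 0, ((((r + p - w) % p : ℕ)) : ZMod p) = cc - x - bb := by
    intro r w cc hr hw
    obtain ⟨x, hx, bb, hbb, rfl⟩ := (hpatt_mem w).1 hw
    refine ⟨x, hx, bb, hbb, ?_⟩
    rw [cast_add_sub_mod (by have := Nat.mod_lt (x.val + bb.val) hp0; omega), hpatt_cast, ← hr, ZMod.natCast_zmod_val]; ring
  set RS := ((C 0).erase 0).image ZMod.val with hRS
  have hRSmem : ∀ r, r ∈ RS ↔ ∃ cc ∈ C 0, cc ≠ 0 ∧ cc.val = r := by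
    intro r; rw [hRS, mem_image]
    constructor
    · rintro ⟨cc, hcc, rfl⟩; exact ⟨cc, (mem_erase.1 hcc).2, (mem_erase.1 hcc).1, rfl⟩
    · rintro ⟨cc, hcc, hne, rfl⟩; exact ⟨cc, mem_erase.2 ⟨hne, hcc⟩, rfl⟩
  obtain ⟨hsub, hlen, hadm, hmemrs⟩ := admissible_filter_transMasks p patt ((transMasks p patt).headD (0, 0)).2 RS
    (by
      intro r hr
      obtain ⟨cc, hcc, hne, rfl⟩ := (hRSmem r).1 hr
      exact ⟨Nat.one_le_iff_ne_zero.2 fun h0 => hne ((ZMod.val_eq_zero cc).1 h0), cc.val_lt⟩)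
    (by
      intro r hr w hw
      obtain ⟨cc, hcc, hne, hr'⟩ := (hRSmem r).1 hr
      obtain ⟨x, hx, bb, hbb, hval⟩ := htrans_mem r w cc hr' hw
      rw [Bool.eq_false_iff]
      intro htb
      rw [hT0] at htb
      obtain ⟨w', hw', hwv⟩ := (tb_transMask p patt 0 _).1 htb
      obtain ⟨x', hx', bb', hbb', hval'⟩ := htrans_mem 0 w' 0 (ZMod.val_zero) hw'
      rw [hwv, hval] at hval'
      obtain ⟨-, -, hc0⟩ := blockSum_inj hS 0 hx hx' hbb hbb' hcc hC00 hval'; exact hne hc0)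
    (by
      intro r hr r' hr' hne w hw w' hw' heq
      obtain ⟨cc, hcc, _, hrv⟩ := (hRSmem r).1 hr
      obtain ⟨cc', hcc', _, hrv'⟩ := (hRSmem r').1 hr'
      obtain ⟨x, hx, bb, hbb, hval⟩ := htrans_mem r w cc hrv hw
      obtain ⟨x', hx', bb', hbb', hval'⟩ := htrans_mem r' w' cc' hrv' hw'
      rw [heq, hval'] at hval
      obtain ⟨-, -, hccc⟩ := blockSum_inj hS 0 hx' hx hbb' hbb hcc' hcc hval; exact hne (by rw [← hrv, ← hrv', hccc]))
  have hlen' : (((transMasks p patt).drop 1).filter fun x => decide (x.1 ∈ RS)).length = c - 1 := by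
    rw [hlen, hRS, Finset.card_image_of_injective _ (ZMod.val_injective p), Finset.card_erase_of_mem hC00, hc]
  set rs := ((transMasks p patt).drop 1).filter fun x => decide (x.1 ∈ RS) with hrs
  have hleaf := caseCLeaf_of_caseCDeadQP' h hpatt rs hsub hlen' hadm
  set cov := rs.foldl (fun cv x => cv ||| x.2) ((transMasks p patt).headD (0, 0)).2 with hcov
  have hcov_mem : ∀ v, tb cov v = true ↔ ∃ e ∈ W, e.val = v := by
    intro v; rw [hcov, tb_foldl_lor, hT0]
    constructor
    · rintro (hv | ⟨x, hx, hv⟩)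
      · obtain ⟨w, hw, hwv⟩ := (tb_transMask p patt 0 _).1 hv
        obtain ⟨x, hx, bb, hbb, hval⟩ := htrans_mem 0 w 0 (ZMod.val_zero) hw
        refine ⟨0 - x - bb, hmemW x hx bb hbb 0 hC00, ?_⟩; rw [← hval, ZMod.val_natCast, Nat.mod_mod, hwv]
      · obtain ⟨hx1, hxe⟩ := (hmemrs x).1 hx
        obtain ⟨cc, hcc, _, hrv⟩ := (hRSmem _).1 hx1
        rw [hxe] at hv
        obtain ⟨w, hw, hwv⟩ := (tb_transMask p patt x.1 _).1 hv
        obtain ⟨x', hx', bb, hbb, hval⟩ := htrans_mem x.1 w cc hrv hw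
        refine ⟨cc - x' - bb, hmemW x' hx' bb hbb cc hcc, ?_⟩; rw [← hval, ZMod.val_natCast, Nat.mod_mod, hwv]
    · rintro ⟨e, he, rfl⟩
      obtain ⟨⟨x, bb, cc⟩, hq, rfl⟩ := mem_image.1 he
      simp only [mem_product] at hq
      obtain ⟨hx, hbb, hcc⟩ := hq
      have hwmem : (x.val + bb.val) % p ∈ patt := (hpatt_mem _).2 ⟨x, hx, bb, hbb, rfl⟩
      have hvaleq : ∀ r : ℕ, (r : ZMod p) = cc → (r + p - (x.val + bb.val) % p) % p = ((0 : ZMod p) + cc - x - bb).val := by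
        intro r hr
        have h' : ((((r + p - (x.val + bb.val) % p) % p : ℕ)) : ZMod p) = (0 : ZMod p) + cc - x - bb := by
          rw [cast_add_sub_mod (by have := Nat.mod_lt (x.val + bb.val) hp0; omega), hpatt_cast, hr]; ring
        have := congrArg ZMod.val h'
        rwa [ZMod.val_natCast, Nat.mod_eq_of_lt (Nat.mod_lt _ hp0)] at this
      by_cases hc0 : cc = 0
      · left
        rw [tb_transMask]; exact ⟨_, hwmem, hvaleq 0 (by rw [hc0, Nat.cast_zero])⟩
      · right
        refine ⟨(cc.val, maskOf (patt.map fun y => (cc.val + p - y) % p)), (hmemrs _).2 ⟨(hRSmem _).2 ⟨cc, hcc, hc0, rfl⟩, rfl⟩, ?_⟩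
        rw [tb_transMask]; exact ⟨_, hwmem, hvaleq cc.val (ZMod.natCast_zmod_val cc)⟩
  have hcov_lt : cov < 2 ^ p := by
    refine Nat.lt_pow_two_of_testBit _ fun i hi => ?_; rw [← tb_eq_testBit, Bool.eq_false_iff]
    intro htb
    obtain ⟨e, _, hev⟩ := (hcov_mem i).1 htb
    have := e.val_lt; omega
  set free := fullMask p ^^^ cov with hfree
  have hfree_lt : free < 2 ^ p := by
    rw [hfree, fullMask_eq]; exact Nat.xor_lt_two_pow (by have := Nat.one_le_two_pow (n := p); omega) hcov_lt
  have hfree_mem : ∀ v, v < p → (tb free v = true ↔ ¬ ∃ e ∈ W, e.val = v) := by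
    intro v hv; rw [hfree, tb_compl hv, ← hcov_mem, Bool.not_eq_true', Bool.eq_false_iff]
  set zc := Q.foldl (fun m q => m &&& rot p free q) (fullMask p) with hzc
  have hZmem : ∀ ζ ∈ DU A C (univ.erase 0), tb zc ζ.val = true := by
    intro ζ hζ; rw [hzc, tb_foldl_land_rot hfree_lt hQlt ζ.val_lt]
    intro q hq
    obtain ⟨bb, hbb, rfl⟩ := (hQmem q).1 hq
    rw [hfree_mem _ (Nat.mod_lt _ hp0), val_sub_eq_mod]
    rintro ⟨e, he, hev⟩
    have hecast : e = ζ - bb := ZMod.val_injective p hev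
    have hinT : ζ - bb ∈ T := by
      have hneg : (0 : ZMod p) - bb ∈ (B 0).image (fun x => (0 : ZMod p) - x) := mem_image.2 ⟨bb, hbb, rfl⟩
      have := Finset.add_mem_add hneg hζ
      convert this using 1; ring
    rw [hecast] at he
    exact Finset.disjoint_left.1 hTWSY hinT (mem_union_left _ he)
  set z0 := ζ₀.val with hz0
  set ivl := (List.range (z + 1)).map fun t => (z0 + t) % p with hivl
  have hivl_cast : ∀ t : ℕ, ((((z0 + t) % p : ℕ)) : ZMod p) = ζ₀ + t := fun t => by rw [cast_add_mod, hz0, ZMod.natCast_zmod_val]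
  have hivl_val : ∀ t : ℕ, (z0 + t) % p = (ζ₀ + t).val := fun t => by
    have := congrArg ZMod.val (hivl_cast t); rwa [ZMod.val_natCast, Nat.mod_eq_of_lt (Nat.mod_lt _ hp0)] at this
  have hivl_nd : ivl.Nodup := by
    rw [hivl]
    refine List.Nodup.map_on (fun t ht t' ht' htt => ?_) (List.nodup_range (n := z + 1))
    have h' := congrArg (fun n : ℕ => (n : ZMod p)) htt
    simp only [hivl_cast, add_right_inj] at h'
    have := congrArg ZMod.val h'
    rwa [ZMod.val_natCast_of_lt (by have := List.mem_range.1 ht; omega),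
      ZMod.val_natCast_of_lt (by have := List.mem_range.1 ht'; omega)] at this
  set hx := (ζ₀ + (h₀ : ZMod p)).val with hhx
  have hZvals : ∀ v, (v ∈ ivl ∧ v ≠ hx) ↔ ∃ ζ ∈ DU A C (univ.erase 0), ζ.val = v := by
    intro v; rw [hivl, List.mem_map, hZ]
    constructor
    · rintro ⟨⟨t, ht, rfl⟩, hne⟩
      refine ⟨ζ₀ + t, mem_image.2 ⟨t, mem_erase.2 ⟨fun hth => hne ?_, mem_range.2 (List.mem_range.1 ht)⟩, rfl⟩, (hivl_val t).symm⟩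
      rw [hivl_val, hth]
    · rintro ⟨ζ, hζ, rfl⟩
      obtain ⟨t, ht, rfl⟩ := mem_image.1 hζ
      refine ⟨⟨t, List.mem_range.2 (mem_range.1 (mem_erase.1 ht).2), hivl_val t⟩, fun hth => (mem_erase.1 ht).1 ?_⟩; rw [hhx] at hth
      have h' := ZMod.val_injective p hth
      have := congrArg ZMod.val (add_left_cancel h')
      rwa [ZMod.val_natCast_of_lt (by have := mem_range.1 (mem_erase.1 ht).2; omega), ZMod.val_natCast_of_lt (by omega)] at this
  set miss := ivl.filter fun x => !(tb zc x) with hmissdef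
  have hmiss_sub : ∀ x ∈ miss, x = hx := by
    intro x hxm
    rw [hmissdef, List.mem_filter] at hxm
    by_contra hne
    obtain ⟨ζ, hζ, hζv⟩ := (hZvals x).1 ⟨hxm.1, hne⟩
    have := hZmem ζ hζ
    rw [hζv] at this
    rw [this] at hxm
    exact Bool.noConfusion hxm.2
  have hmiss : miss.length ≤ 1 := by
    have hnd : miss.Nodup := hivl_nd.filter _
    rw [← List.toFinset_card_of_nodup hnd]
    refine Finset.card_le_one.2 fun x hx' y hy' => ?_; rw [List.mem_toFinset] at hx' hy'
    rw [hmiss_sub x hx', hmiss_sub y hy']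
  have hhxivl : hx ∈ ivl := by rw [hivl, List.mem_map]; exact ⟨h₀, List.mem_range.2 (by omega), hivl_val h₀⟩
  have hhx' : hx ∈ cond (Nat.beq miss.length 0) ivl miss := by
    cases hm : Nat.beq miss.length 0
    · -- miss non-empty
      have hne : miss ≠ [] := fun h0 => by rw [h0, List.length_nil] at hm; exact Bool.noConfusion hm
      obtain ⟨x, hxm⟩ := List.exists_mem_of_ne_nil miss hne
      have := hmiss_sub x hxm
      rw [this] at hxm
      exact hxm
    · exact hhxivl
  set Zo := ivl.filter fun x => !(Nat.beq x hx) with hZodef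
  have hZo_mem : ∀ v, v ∈ Zo ↔ ∃ ζ ∈ DU A C (univ.erase 0), ζ.val = v := by
    intro v; rw [hZodef, List.mem_filter, ← hZvals]
    constructor
    · rintro ⟨h1', h2'⟩
      refine ⟨h1', fun hv => ?_⟩; rw [hv, Nat.beq_refl] at h2'
      exact Bool.noConfusion h2'
    · rintro ⟨h1', h2'⟩
      refine ⟨h1', ?_⟩
      cases hb : Nat.beq v hx
      · rfl
      · exact absurd (Nat.eq_of_beq_eq_true hb) h2'
  have hZo_lt : ∀ v ∈ Zo, v < p := fun v hv => by obtain ⟨ζ, _, rfl⟩ := (hZo_mem v).1 hv; exact ζ.val_lt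
  set tM := Q.foldl (fun m q => m ||| rot p (maskOf Zo) (p - q)) 0 with htMdef
  have htM_mem : ∀ v, v < p → (tb tM v = true ↔ ∃ e ∈ T, e.val = v) := by
    intro v hv; rw [htMdef, tb_foldl_lor_rot (maskOf_lt_two_pow hZo_lt) hQlt hv]
    constructor
    · rintro ⟨q, hq, htb⟩
      obtain ⟨bb, hbb, rfl⟩ := (hQmem q).1 hq
      obtain ⟨ζ, hζ, hζv⟩ := (hZo_mem _).1 ((tb_maskOf _ _).1 htb)
      refine ⟨(0 - bb) + ζ, Finset.add_mem_add (mem_image.2 ⟨bb, hbb, rfl⟩) hζ, ?_⟩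
      have h' : ((((v + bb.val) % p : ℕ)) : ZMod p) = (v : ZMod p) + bb := by rw [cast_add_mod, ZMod.natCast_zmod_val]
      have hζe : ζ = (v : ZMod p) + bb := by
        have := congrArg (fun n : ℕ => (n : ZMod p)) hζv; simp only [ZMod.natCast_zmod_val, h'] at this; exact this
      rw [hζe, show (0 : ZMod p) - bb + ((v : ZMod p) + bb) = v by ring, ZMod.val_natCast_of_lt hv]
    · rintro ⟨e, he, hev⟩
      obtain ⟨nb, hnb, ζ, hζ, rfl⟩ := Finset.mem_add.1 he
      obtain ⟨bb, hbb, rfl⟩ := mem_image.1 hnb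
      refine ⟨bb.val, (hQmem _).2 ⟨bb, hbb, rfl⟩, (tb_maskOf _ _).2 ((hZo_mem _).2 ⟨ζ, hζ, ?_⟩)⟩
      have h' : ((((v + bb.val) % p : ℕ)) : ZMod p) = (v : ZMod p) + bb := by rw [cast_add_mod, ZMod.natCast_zmod_val]
      have hv' : (v : ZMod p) = 0 - bb + ζ := by rw [← hev, ZMod.natCast_zmod_val]
      have := congrArg ZMod.val (show ((((v + bb.val) % p : ℕ)) : ZMod p) = ζ by rw [h', hv']; ring)
      rw [ZMod.val_natCast, Nat.mod_eq_of_lt (Nat.mod_lt _ hp0)] at this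
      exact this.symm
  have htM_lt : tM < 2 ^ p := by
    refine Nat.lt_pow_two_of_testBit _ fun i hi => ?_
    rw [← tb_eq_testBit, Bool.eq_false_iff]
    intro htb
    rw [htMdef, tb_foldl_lor_fun] at htb
    rcases htb with htb | ⟨q, _, htb⟩
    · rw [tb_zero] at htb; exact Bool.noConfusion htb
    · rw [tb_eq_false_of_lt (rot_lt_two_pow p _ _) hi] at htb; exact Bool.noConfusion htb
  have htMcard : popc (List.range p) tM = Q.length + z := by
    rw [hQlen, hb, ← hT, popc_eq_length_members]
    have hnd : (members (List.range p) tM).Nodup := nodup_members List.nodup_range _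
    have hset : (members (List.range p) tM).toFinset = T.image ZMod.val := by
      ext v
      rw [List.mem_toFinset, mem_members, List.mem_range, mem_image]
      constructor
      · rintro ⟨hv, htb⟩; exact (htM_mem v hv).1 htb
      · rintro ⟨e, he, rfl⟩; exact ⟨e.val_lt, (htM_mem _ e.val_lt).2 ⟨e, he, rfl⟩⟩
    rw [← List.toFinset_card_of_nodup hnd, hset, card_image_of_injective _ (ZMod.val_injective p)]
  set sy := free ^^^ tM with hsydef
  have hpart' : ∀ e : ZMod p, e ∈ W ∨ e ∈ SY ∨ e ∈ T := by
    intro e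
    have : e ∈ W ∪ SY ∪ T := by rw [hpart]; exact mem_univ e
    simpa [mem_union, or_assoc] using this
  have hsy_mem : ∀ v, v < p → (tb sy v = true ↔ ∃ e ∈ SY, e.val = v) := by
    intro v hv; rw [hsydef, tb_xor]
    have hf := hfree_mem v hv
    have ht := htM_mem v hv
    constructor
    · intro hx'
      set e : ZMod p := (v : ZMod p) with he
      have hev : e.val = v := ZMod.val_natCast_of_lt hv
      rcases hpart' e with heW | heSY | heT
      · -- v ∈ W ⇒ free false, T false (disjoint) ⇒ xor false
        have h1' : tb free v = false := by rw [Bool.eq_false_iff, ne_eq, hf, not_not]; exact ⟨e, heW, hev⟩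
        have h2' : tb tM v = false := by
          rw [Bool.eq_false_iff, ne_eq, ht]; rintro ⟨e', he', hev'⟩
          have : e' = e := ZMod.val_injective p (hev'.trans hev.symm)
          rw [this] at he'
          exact Finset.disjoint_left.1 hTWSY he' (mem_union_left _ heW)
        rw [h1', h2'] at hx'; exact Bool.noConfusion hx'
      · exact ⟨e, heSY, hev⟩
      · have h1' : tb free v = true := by
          rw [hf]; rintro ⟨e', he', hev'⟩
          have : e' = e := ZMod.val_injective p (hev'.trans hev.symm)
          rw [this] at he'
          exact Finset.disjoint_left.1 hTWSY heT (mem_union_left _ he')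
        have h2' : tb tM v = true := (ht).2 ⟨e, heT, hev⟩
        rw [h1', h2'] at hx'; exact Bool.noConfusion hx'
    · rintro ⟨e, heSY, hev⟩
      have h1' : tb free v = true := by
        rw [hf]; rintro ⟨e', he', hev'⟩
        have : e' = e := ZMod.val_injective p (hev'.trans hev.symm)
        rw [this] at he'
        exact Finset.disjoint_left.1 hWSY he' heSY
      have h2' : tb tM v = false := by
        rw [Bool.eq_false_iff, ne_eq, ht]; rintro ⟨e', he', hev'⟩
        have : e' = e := ZMod.val_injective p (hev'.trans hev.symm)
        rw [this] at he'
        exact Finset.disjoint_left.1 hTWSY he' (mem_union_right _ heSY)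
      rw [h1', h2']; rfl
  have hsy_lt : sy < 2 ^ p := by rw [hsydef]; exact Nat.xor_lt_two_pow hfree_lt htM_lt
  have hmemSYel : ∀ x ∈ A 0, ∀ yy ∈ DU B C (univ.erase 0), yy - x ∈ SY := fun x hx yy hyy => by
    have hneg : (0 : ZMod p) - x ∈ (A 0).image (fun t => (0 : ZMod p) - t) := mem_image.2 ⟨x, hx, rfl⟩
    have := Finset.add_mem_add hneg hyy
    convert this using 1; ring
  set yc := P.foldl (fun m x => m &&& rot p sy x) (fullMask p) with hycdef
  have hYmem : ∀ yy ∈ DU B C (univ.erase 0), yy.val ∈ members (List.range p) yc := by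
    intro yy hyy; rw [mem_members, List.mem_range]
    refine ⟨yy.val_lt, ?_⟩
    rw [hycdef, tb_foldl_land_rot hsy_lt hPlt yy.val_lt]
    intro xv hxv
    obtain ⟨x, hx, rfl⟩ := (hPmem xv).1 hxv
    rw [hsy_mem _ (Nat.mod_lt _ hp0), val_sub_eq_mod]; exact ⟨yy - x, hmemSYel x hx yy hyy, rfl⟩
  have hYcard : #(DU B C (univ.erase 0)) = L := by rw [card_DU_BC hS hA, h1, sum_singleton, hb₀, hc₀, hL]
  set Yo := (members (List.range p) yc).filter fun v => decide (v ∈ (DU B C (univ.erase 0)).image ZMod.val) with hYodef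
  have hYo_sub : Yo ∈ (members (List.range p) yc).sublistsLen L := by
    rw [← hYcard, ← card_image_of_injective (DU B C (univ.erase 0)) (ZMod.val_injective p)]; exact filter_mem_sublistsLen _ (nodup_members List.nodup_range _) _ fun v hv => by
      obtain ⟨yy, hyy, rfl⟩ := mem_image.1 hv; exact hYmem yy hyy
  have hYo_mem : ∀ v, v ∈ Yo ↔ ∃ e ∈ DU B C (univ.erase 0), e.val = v := by
    intro v; rw [hYodef, List.mem_filter, decide_eq_true_eq, mem_image]
    constructor
    · exact fun h' => h'.2
    · rintro ⟨yy, hyy, rfl⟩; exact ⟨hYmem yy hyy, yy, hyy, rfl⟩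
  have hYo_nd : Yo.Nodup := (nodup_members List.nodup_range _).filter _
  have hYo_lt : ∀ v ∈ Yo, v < p := fun v hv => by obtain ⟨e, _, rfl⟩ := (hYo_mem v).1 hv; exact e.val_lt
  have hsyM : P.foldl (fun m x => m ||| rot p (maskOf Yo) (p - x)) 0 = sy := by
    apply Nat.eq_of_testBit_eq
    intro i; rw [← tb_eq_testBit, ← tb_eq_testBit]
    by_cases hi : i < p
    · rw [Bool.eq_iff_iff, tb_foldl_lor_rot (maskOf_lt_two_pow hYo_lt) hPlt hi, hsy_mem i hi]
      constructor
      · rintro ⟨xv, hxv, htb⟩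
        obtain ⟨x, hx, rfl⟩ := (hPmem xv).1 hxv
        obtain ⟨yy, hyy, hyv⟩ := (hYo_mem _).1 ((tb_maskOf _ _).1 htb)
        refine ⟨yy - x, hmemSYel x hx yy hyy, ?_⟩
        have h' : ((((i + x.val) % p : ℕ)) : ZMod p) = (i : ZMod p) + x := by rw [cast_add_mod, ZMod.natCast_zmod_val]
        have hye : yy = (i : ZMod p) + x := by
          have := congrArg (fun n : ℕ => (n : ZMod p)) hyv; simp only [ZMod.natCast_zmod_val, h'] at this; exact this
        rw [hye, show (i : ZMod p) + x - x = i by ring, ZMod.val_natCast_of_lt hi]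
      · rintro ⟨e, he, hev⟩
        obtain ⟨nx, hnx, yy, hyy, rfl⟩ := Finset.mem_add.1 he
        obtain ⟨x, hx, rfl⟩ := mem_image.1 hnx
        refine ⟨x.val, (hPmem _).2 ⟨x, hx, rfl⟩, (tb_maskOf _ _).2 ((hYo_mem _).2 ⟨yy, hyy, ?_⟩)⟩
        have h' : ((((i + x.val) % p : ℕ)) : ZMod p) = (i : ZMod p) + x := by rw [cast_add_mod, ZMod.natCast_zmod_val]
        have hv' : (i : ZMod p) = 0 - x + yy := by rw [← hev, ZMod.natCast_zmod_val]
        have := congrArg ZMod.val (show ((((i + x.val) % p : ℕ)) : ZMod p) = yy by rw [h', hv']; ring)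
        rw [ZMod.val_natCast, Nat.mod_eq_of_lt (Nat.mod_lt _ hp0)] at this
        exact this.symm
    · rw [not_lt] at hi
      have h1' : tb (P.foldl (fun m x => m ||| rot p (maskOf Yo) (p - x)) 0) i = false := by
        rw [Bool.eq_false_iff]; intro htb
        rw [tb_foldl_lor_fun] at htb
        rcases htb with htb | ⟨q, _, htb⟩
        · rw [tb_zero] at htb; exact Bool.noConfusion htb
        · rw [tb_eq_false_of_lt (rot_lt_two_pow p _ _) hi] at htb; exact Bool.noConfusion htb
      rw [h1', tb_eq_false_of_lt hsy_lt hi]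
  have hreal := realisationsDead_of_caseCLeaf hleaf z0 ζ₀.val_lt hmiss hx hhx' htMcard Yo hYo_sub hsyM
  have hR_mem : ∀ v, v ∈ [0] ++ rs.map Prod.fst → ∃ cc ∈ C 0, cc.val = v := by
    intro v hv
    rw [List.mem_append, List.mem_singleton, List.mem_map] at hv
    rcases hv with rfl | ⟨x, hx, rfl⟩
    · exact ⟨0, hC00, ZMod.val_zero⟩
    · obtain ⟨hx1, _⟩ := (hmemrs x).1 hx
      obtain ⟨cc, hcc, _, hcv⟩ := (hRSmem _).1 hx1; exact ⟨cc, hcc, hcv⟩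
  exact false_of_realisationsDead hS hA hB hC ha₀ hb₀ hc₀ hB10 hPmem hQmem hR_mem hYo_mem hYo_nd hZo_mem hreal
end Summit.MatrixMultiplication.OmegaCensus.CubeNB.S2
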